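import Mathlib
import Summits.AtomisticToContinuum.HydrodynamicLimit.Theorems.ImplosionDichotomyDenseExcursionR2Modes
import Literature.Analysis.ODE.OneSidedComparison

/-!
# Far-field weighted boundedness of real solutions of the radial resolvent system
# (crux `DenseExcursion`, stmt-AtomisticToContinuum-12586, line `sonic-cavity-renewal` v7, stub `stub_packingResolvent`)

Helper file (`--supports stmt-AtomisticToContinuum-12586`) for the registered stub `stub_packingResolvent` (skeleton v7) of
the line `sonic-cavity-renewal`; it proves the registered helper `packingResolvent_farField`, the far-field half of the
GLOBAL finiteness clause `∃ N', ∀ y, |u₁ y| + |u₂ y| / S y ≤ N'` of `PackingResolvent` (`…PackingAnalyticDefsB`).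

**Statement.** Let `IsMonatomicProfile r W S` (so `W, S` are smooth, `S > 0`, `Δ W′ = −Δ₁`, `Δ S′ = −Δ₂`, and
`W, S → 0` as `x → +∞`), let `Λ > 0`, and let `(u₁, u₂)` be a differentiable REAL solution of the resolvent system
`Λ u − L u = f`, `L = (linW, linS)` written out in real form, whose source has bounded weighted size
`|f₁| + |f₂|/S ≤ N` on `x ≥ 0`. Then `|u₁| + |u₂|/S` is bounded on `x ≥ 0` — for EVERY solution, no selection: the
far field is forward-stable.

**Mathematics.** (1) `profile_farField_limits`: from the `Δ`-form of the profile equations and `W, S → 0`,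
`Δ = (W − 1)² − S² → 1`, `W′ = −Δ₁/Δ → 0`, `S′/S = −Δ₂/(SΔ) → −r`. (2) In the variables `p = u₁`, `q = u₂/S` the system
reads (Cramer, `farField_cramer`) `p′ = A₁₁p + A₁₂q + g₁`, `q′ = A₂₁p + A₂₂q + g₂` with coefficients rational in the four
atoms `(W, W′, S, S′/S) → (0, 0, 0, −r)`, hence `A₁₁ → −(Λ + r)`, `A₁₂ → 0`, `A₂₁ → c := 2 − r − (Λ + r)/3`, `A₂₂ → −Λ`,
and forcings `g₁ = B₁₁f₁ + B₁₂ f₂/S`, `g₂ = B₂₁f₁ + B₂₂f₂/S` with `(B₁₁, B₁₂, B₂₁, B₂₂) → (1, 0, 1/3, 1)`, so `|gᵢ| ≤ 3N`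
eventually. (3) `bounded_of_decaying_system` (the abstract energy lemma): for `E = p² + εq²` with `ε = λ²/(8c² + 8)`,
`λ = Λ/2`, one has `E′ ≤ −λE + K` beyond some `X₀` (AM–GM on the cross term, `(A₁₂ + εA₂₁)² ≤ ελ²/4`), and the signed
scalar Grönwall lemma `le_gronwallBound_of_deriv_right_le` (`Literature/Analysis/ODE/OneSidedComparison`) with NEGATIVE
rate bounds `E ≤ E(X₀) + K/λ`. (4) `[0, X₀]` is compact.

Sources: Coddington–Levinson 1955 Ch. 3 §§1–2 (asymptotic stability of linear systems with almost-constant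
coefficients); Coppel 1965 Ch. III (dichotomies, bounded forcing). NOT here: the stub, the core part `x ≤ 1`.
-/

noncomputable section

open Filter Set Topology

namespace Summit.AtomisticToContinuum.HydrodynamicLimit.Theorems.PackingAnalyticImplosion

open Summit.AtomisticToContinuum.HydrodynamicLimit.Theorems.R2OneModeTwoConditions

/-! ## The abstract energy lemma: a forced planar linear system with a stable lower-triangular limit -/



/-- **FORCED DECAYING PLANAR SYSTEM ⇒ BOUNDED.** If `p′ = A₁₁p + A₁₂q + g₁`, `q′ = A₂₁p + A₂₂q + g₂` on `x ≥ X₀` with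
`A₁₁, A₂₂ ≤ −λ < 0`, cross term `(A₁₂ + εA₂₁)² ≤ ελ²/4` and forcings `|gᵢ| ≤ G`, then `p`, `q` are bounded on `x ≥ X₀`:
the energy `E = p² + εq²` satisfies `E′ ≤ −λE + 2(1 + ε)G²/λ`, and the signed scalar Grönwall bound with negative rate is
uniform in `x`. [folklore] -/
theorem bounded_of_decaying_system {p q p' q' A₁₁ A₁₂ A₂₁ A₂₂ g₁ g₂ : ℝ → ℝ} {X₀ lam ε G : ℝ}
    (hlam : 0 < lam) (hε : 0 < ε)
    (hp : ∀ x, X₀ ≤ x → HasDerivAt p (p' x) x) (hq : ∀ x, X₀ ≤ x → HasDerivAt q (q' x) x)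
    (hpe : ∀ x, X₀ ≤ x → p' x = A₁₁ x * p x + A₁₂ x * q x + g₁ x)
    (hqe : ∀ x, X₀ ≤ x → q' x = A₂₁ x * p x + A₂₂ x * q x + g₂ x)
    (h11 : ∀ x, X₀ ≤ x → A₁₁ x ≤ -lam) (h22 : ∀ x, X₀ ≤ x → A₂₂ x ≤ -lam)
    (h12 : ∀ x, X₀ ≤ x → (A₁₂ x + ε * A₂₁ x) ^ 2 ≤ ε * lam ^ 2 / 4)
    (hg₁ : ∀ x, X₀ ≤ x → |g₁ x| ≤ G) (hg₂ : ∀ x, X₀ ≤ x → |g₂ x| ≤ G) :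
    ∃ M : ℝ, ∀ x, X₀ ≤ x → |p x| ≤ M ∧ |q x| ≤ M := by
  -- the energy and its derivative
  set E : ℝ → ℝ := fun x => p x ^ 2 + ε * q x ^ 2 with hE
  set E' : ℝ → ℝ := fun x => (p' x * p x + p x * p' x) + ε * (q' x * q x + q x * q' x) with hE'
  have hEd : ∀ x, X₀ ≤ x → HasDerivAt E (E' x) x := by
    intro x hx
    have e1 : (fun y => p y ^ 2) = fun y => p y * p y := funext fun y => sq (p y)
    have e2 : (fun y => q y ^ 2) = fun y => q y * q y := funext fun y => sq (q y)
    have h1 : HasDerivAt (fun y => p y ^ 2) (p' x * p x + p x * p' x) x := by rw [e1]; exact (hp x hx).mul (hp x hx)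
    have h2 : HasDerivAt (fun y => q y ^ 2) (q' x * q x + q x * q' x) x := by rw [e2]; exact (hq x hx).mul (hq x hx)
    exact h1.add (h2.const_mul ε)
  set K : ℝ := 2 * (1 + ε) * G ^ 2 / lam with hK
  have hK0 : 0 ≤ K := by positivity
  have hlamK : lam * K = 2 * (1 + ε) * G ^ 2 := by rw [hK]; field_simp
  -- the differential inequality `E' ≤ -lam E + K`
  have hineq : ∀ x, X₀ ≤ x → E' x ≤ -lam * E x + K := by
    intro x hx
    have e1 := hpe x hx; have e2 := hqe x hx
    set P := p x; set Q := q x; set t := A₁₂ x + ε * A₂₁ x with ht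
    have hA : A₁₁ x * P ^ 2 ≤ -lam * P ^ 2 := mul_le_mul_of_nonneg_right (h11 x hx) (sq_nonneg _)
    have hB : A₂₂ x * Q ^ 2 ≤ -lam * Q ^ 2 := mul_le_mul_of_nonneg_right (h22 x hx) (sq_nonneg _)
    have hC : 4 * (t * (P * Q)) ≤ lam * P ^ 2 + ε * lam * Q ^ 2 := by
      have h4 : 4 * t ^ 2 ≤ ε * lam ^ 2 := by have := h12 x hx; linarith
      have key : 0 ≤ lam * (lam * P ^ 2 + ε * lam * Q ^ 2 - 4 * (t * (P * Q))) := by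
        nlinarith [sq_nonneg (lam * P - 2 * t * Q), mul_nonneg (sub_nonneg.2 h4) (sq_nonneg Q)]
      nlinarith
    have hD : 4 * (g₁ x * P) * lam ≤ lam ^ 2 * P ^ 2 + 4 * G ^ 2 := by
      have h1 : g₁ x * P ≤ G * |P| := by
        calc g₁ x * P ≤ |g₁ x * P| := le_abs_self _
          _ = |g₁ x| * |P| := abs_mul _ _
          _ ≤ G * |P| := mul_le_mul_of_nonneg_right (hg₁ x hx) (abs_nonneg _)
      nlinarith [sq_nonneg (lam * |P| - 2 * G), sq_abs P]
    have hD' : 4 * (g₂ x * Q) * lam ≤ lam ^ 2 * Q ^ 2 + 4 * G ^ 2 := by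
      have h1 : g₂ x * Q ≤ G * |Q| := by
        calc g₂ x * Q ≤ |g₂ x * Q| := le_abs_self _
          _ = |g₂ x| * |Q| := abs_mul _ _
          _ ≤ G * |Q| := mul_le_mul_of_nonneg_right (hg₂ x hx) (abs_nonneg _)
      nlinarith [sq_nonneg (lam * |Q| - 2 * G), sq_abs Q]
    have hEx : E x = P ^ 2 + ε * Q ^ 2 := rfl
    have hE'x : E' x = (p' x * P + P * p' x) + ε * (q' x * Q + Q * q' x) := rfl
    rw [hEx, hE'x, e1, e2]
    have hA2 := mul_le_mul_of_nonneg_left hA (by positivity : (0 : ℝ) ≤ 2 * lam)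
    have hB2 := mul_le_mul_of_nonneg_left hB (by positivity : (0 : ℝ) ≤ 2 * lam * ε)
    have hC2 := mul_le_mul_of_nonneg_left hC (by positivity : (0 : ℝ) ≤ lam / 2)
    have hD2 := mul_le_mul_of_nonneg_left hD' (by positivity : (0 : ℝ) ≤ ε / 2)
    have hfin : lam * ((A₁₁ x * P + A₁₂ x * Q + g₁ x) * P + P * (A₁₁ x * P + A₁₂ x * Q + g₁ x) +
        ε * ((A₂₁ x * P + A₂₂ x * Q + g₂ x) * Q + Q * (A₂₁ x * P + A₂₂ x * Q + g₂ x))) ≤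
        lam * (-lam * (P ^ 2 + ε * Q ^ 2) + K) := by
      rw [mul_add lam (-lam * (P ^ 2 + ε * Q ^ 2)) K, hlamK, ht] at *
      linarith
    exact le_of_mul_le_mul_left hfin hlam
  -- Grönwall on `[X₀, b]` for every `b`
  have hbound : ∀ x, X₀ ≤ x → E x ≤ E X₀ + K / lam := by
    intro x hx
    have hcont : ContinuousOn E (Icc X₀ x) := fun y hy => (hEd y hy.1).continuousAt.continuousWithinAt
    have hder : ∀ y ∈ Ico X₀ x, HasDerivWithinAt E (E' y) (Ici y) y :=
      fun y hy => (hEd y hy.1).hasDerivWithinAt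
    have h := Literature.Analysis.ODE.le_gronwallBound_of_deriv_right_le (f := E) (f' := E') (a := X₀) (b := x)
      (α := K) (β := -lam) hcont hder (fun y hy => by have := hineq y hy.1; linarith) x ⟨hx, le_rfl⟩
    rw [gronwallBound_of_K_ne_0 (neg_ne_zero.2 hlam.ne')] at h
    have hexp1 : Real.exp (-lam * (x - X₀)) ≤ 1 := Real.exp_le_one_iff.2 (by nlinarith)
    have hE0 : 0 ≤ E X₀ := by simp only [hE]; positivity
    have h2 : K / -lam * (Real.exp (-lam * (x - X₀)) - 1) = K / lam * (1 - Real.exp (-lam * (x - X₀))) := by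
      rw [div_neg]; ring
    have h3 : K / lam * (1 - Real.exp (-lam * (x - X₀))) ≤ K / lam * 1 :=
      mul_le_mul_of_nonneg_left (by linarith [Real.exp_pos (-lam * (x - X₀))]) (div_nonneg hK0 hlam.le)
    have h4 : E X₀ * Real.exp (-lam * (x - X₀)) ≤ E X₀ * 1 := mul_le_mul_of_nonneg_left hexp1 hE0
    have h5 : E x ≤ E X₀ * Real.exp (-lam * (x - X₀)) + K / -lam * (Real.exp (-lam * (x - X₀)) - 1) := h
    rw [h2] at h5
    linarith
  -- read off `|p|`, `|q|`
  set Emax : ℝ := E X₀ + K / lam with hEmax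
  refine ⟨1 + Emax + Emax / ε, fun x hx => ?_⟩
  have hEx := hbound x hx
  have hExE : E x = p x ^ 2 + ε * q x ^ 2 := rfl
  rw [hExE] at hEx
  have hE0 : 0 ≤ Emax := le_trans (by positivity) hEx
  have hp2 : p x ^ 2 ≤ Emax := le_trans (by nlinarith [sq_nonneg (q x)]) hEx
  have hq2 : q x ^ 2 ≤ Emax / ε := by rw [le_div_iff₀ hε]; nlinarith [sq_nonneg (p x)]
  have key : ∀ (z B : ℝ), 0 ≤ B → z ^ 2 ≤ B → |z| ≤ 1 + B := by
    intro z B hB hz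
    by_contra hcon; push Not at hcon
    have h2 : |z| ^ 2 ≤ B := by rwa [sq_abs]
    nlinarith [abs_nonneg z]
  have := key (p x) Emax hE0 hp2
  have := key (q x) (Emax / ε) (div_nonneg hE0 hε.le) hq2
  have : 0 ≤ Emax / ε := div_nonneg hE0 hε.le
  exact ⟨by linarith, by linarith⟩

/-! ## The far field of a monatomic profile -/

/-- **FAR-FIELD LIMITS OF A MONATOMIC PROFILE**: `W → 0`, `S → 0` (definition), and from the `Δ`-form of the profile
equations `W′ = −Δ₁/Δ → 0`, `S′/S = −Δ₂/(SΔ) → −r`, `Δ = (W − 1)² − S² → 1`. [folklore] -/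
theorem profile_farField_limits {r : ℝ} {W S : ℝ → ℝ} (hP : IsMonatomicProfile r W S) :
    Tendsto W atTop (𝓝 0) ∧ Tendsto S atTop (𝓝 0) ∧ Tendsto (deriv W) atTop (𝓝 0) ∧
      Tendsto (fun x => deriv S x / S x) atTop (𝓝 (-r)) ∧
      Tendsto (fun x => (W x - 1) ^ 2 - S x ^ 2) atTop (𝓝 1) := by
  obtain ⟨-, -, -, -, hSpos, hode, -, hW, hS⟩ := hP
  have hSW : Tendsto (fun x => (S x, W x)) atTop (𝓝 (0, 0)) := hS.prodMk_nhds hW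
  -- polynomial expressions of `(S, W)` tend to their values at `(0, 0)`
  have hpoly : ∀ Φ : ℝ × ℝ → ℝ, Continuous Φ → Tendsto (fun x => Φ (S x, W x)) atTop (𝓝 (Φ (0, 0))) :=
    fun Φ hΦ => (hΦ.tendsto (0, 0)).comp hSW
  have hD : Tendsto (fun x => (W x - 1) ^ 2 - S x ^ 2) atTop (𝓝 1) := by
    have h := hpoly (fun v => (v.2 - 1) ^ 2 - v.1 ^ 2) (by fun_prop)
    norm_num at h; exact h
  have hDelta : ∀ x, Delta (S x) (W x) = (W x - 1) ^ 2 - S x ^ 2 := fun x => by unfold Delta; ring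
  have hD' : ∀ᶠ x in atTop, (1 / 2 : ℝ) < (W x - 1) ^ 2 - S x ^ 2 := hD.eventually (lt_mem_nhds (by norm_num))
  refine ⟨hW, hS, ?_, ?_, hD⟩
  · -- `W' = -Δ₁/Δ → 0`
    have h1 : Tendsto (fun x => -Delta1 r (S x) (W x) / ((W x - 1) ^ 2 - S x ^ 2)) atTop (𝓝 0) := by
      have h := (hpoly (fun v => -Delta1 r v.1 v.2) (by unfold Delta1; fun_prop)).div hD one_ne_zero
      have h0 : -Delta1 r 0 0 / 1 = 0 := by simp [Delta1]
      exact h0 ▸ h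
    refine h1.congr' ?_
    filter_upwards [hD'] with x hx
    have hDx : (W x - 1) ^ 2 - S x ^ 2 ≠ 0 := by linarith
    have := (hode x).1
    rw [hDelta] at this
    field_simp
    linarith
  · -- `S'/S = -Δ₂/(S Δ) → -r`
    have h1 : Tendsto (fun x => -(5 * W x ^ 2 - (6 + 2 * r) * W x + 3 * r - 3 * S x ^ 2) / 3 /
        ((W x - 1) ^ 2 - S x ^ 2)) atTop (𝓝 (-r)) := by
      have h := (hpoly (fun v => -(5 * v.2 ^ 2 - (6 + 2 * r) * v.2 + 3 * r - 3 * v.1 ^ 2) / 3)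
        (by fun_prop)).div hD one_ne_zero
      have h0 : -(5 * (0 : ℝ) ^ 2 - (6 + 2 * r) * 0 + 3 * r - 3 * 0 ^ 2) / 3 / 1 = -r := by ring
      exact h0 ▸ h
    refine h1.congr' ?_
    filter_upwards [hD'] with x hx
    have hDx : (W x - 1) ^ 2 - S x ^ 2 ≠ 0 := by linarith
    have hSx : S x ≠ 0 := (hSpos x).ne'
    have := (hode x).2
    rw [hDelta, Delta2] at this
    field_simp
    linear_combination (-3) * this

/-- **CRAMER IN THE FAR-FIELD VARIABLES** (pure algebra): from the two real resolvent equations at a point, with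
`b = S ≠ 0` and `D = (a − 1)² − b² ≠ 0`, the derivatives `P′ = u₁′` and `(u₂/S)′ = (U′b − Ub′)/b²` are the explicit affine
expressions in `P = u₁`, `U/b = u₂/S`, `F = f₁`, `H/b = f₂/S` whose coefficients are rational in `(a, a′, b, b′/b)` with
denominator `D`. [folklore] -/
theorem farField_cramer (Λ r a a' b b' P P' U U' F H : ℝ) (hb : b ≠ 0) (hD : (a - 1) ^ 2 - b ^ 2 ≠ 0)
    (e1 : Λ * P - ((a - 1) * P' + 3 * b * U' + (a' + 2 * a - r) * P + (3 * b' + 6 * b) * U) = F)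
    (e2 : Λ * U - (b / 3 * P' + (a - 1) * U' + (b' + 2 * b) * P + (a' / 3 + 2 * a - r) * U) = H) :
    P' = ((a - 1) * (Λ + r - a' - 2 * a) + 3 * b ^ 2 * (b' / b + 2)) / ((a - 1) ^ 2 - b ^ 2) * P +
        (-(a - 1) * (6 * (b' / b + 1) * b ^ 2) - 3 * b ^ 2 * (Λ + r - a' / 3 - 2 * a - (a - 1) * (b' / b))) /
          ((a - 1) ^ 2 - b ^ 2) * (U / b) +
        (-(a - 1) / ((a - 1) ^ 2 - b ^ 2) * F + 3 * b ^ 2 / ((a - 1) ^ 2 - b ^ 2) * (H / b)) ∧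
    (U' * b - U * b') / b ^ 2 =
      (-(1 / 3) * (Λ + r - a' - 2 * a) - (a - 1) * (b' / b + 2)) / ((a - 1) ^ 2 - b ^ 2) * P +
        (2 * (b' / b + 1) * b ^ 2 + (a - 1) * (Λ + r - a' / 3 - 2 * a - (a - 1) * (b' / b))) /
          ((a - 1) ^ 2 - b ^ 2) * (U / b) +
        (1 / 3 / ((a - 1) ^ 2 - b ^ 2) * F + -(a - 1) / ((a - 1) ^ 2 - b ^ 2) * (H / b)) := by
  have c1 : ((a - 1) ^ 2 - b ^ 2) * P' = (a - 1) * (Λ * P - (a' + 2 * a - r) * P - (3 * b' + 6 * b) * U - F)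
      - 3 * b * (Λ * U - (b' + 2 * b) * P - (a' / 3 + 2 * a - r) * U - H) := by
    linear_combination (-(a - 1)) * e1 + (3 * b) * e2
  have c2 : ((a - 1) ^ 2 - b ^ 2) * U' = (a - 1) * (Λ * U - (b' + 2 * b) * P - (a' / 3 + 2 * a - r) * U - H)
      - b / 3 * (Λ * P - (a' + 2 * a - r) * P - (3 * b' + 6 * b) * U - F) := by
    linear_combination (-(a - 1)) * e2 + (b / 3) * e1
  have hP' : P' = ((a - 1) * (Λ * P - (a' + 2 * a - r) * P - (3 * b' + 6 * b) * U - F)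
      - 3 * b * (Λ * U - (b' + 2 * b) * P - (a' / 3 + 2 * a - r) * U - H)) / ((a - 1) ^ 2 - b ^ 2) := by
    rw [eq_div_iff hD]; linear_combination c1
  have hU' : U' = ((a - 1) * (Λ * U - (b' + 2 * b) * P - (a' / 3 + 2 * a - r) * U - H)
      - b / 3 * (Λ * P - (a' + 2 * a - r) * P - (3 * b' + 6 * b) * U - F)) / ((a - 1) ^ 2 - b ^ 2) := by
    rw [eq_div_iff hD]; linear_combination c2
  constructor
  · rw [hP']; field_simp; ring
  · rw [hU']; field_simp; ring

/-! ## The registered helper -/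

/-- **Helper `packingResolvent_farField` of `stub_packingResolvent`: FAR-FIELD WEIGHTED BOUNDEDNESS.** For a monatomic
profile, `Λ > 0`, and a differentiable real solution `(u₁, u₂)` of `Λu − Lu = f` (real form of `linW`, `linS`) whose source
satisfies `|f₁| + |f₂|/S ≤ N` on `x ≥ 0`, the weighted size `|u₁| + |u₂|/S` is bounded on `x ≥ 0`. In `(p, q) = (u₁, u₂/S)`
the system tends to the stable lower-triangular limit `p′ = −(Λ + r)p + f₁`, `q′ = cp − Λq + f₁/3 + f₂/S`
(`profile_farField_limits`, `farField_cramer`); `bounded_of_decaying_system` bounds it beyond some `X₀ ≥ 0`, and `[0, X₀]`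
is compact. [folklore] -/
theorem packingResolvent_farField : ∀ (r Λ : ℝ) (W S u₁ u₂ f₁ f₂ : ℝ → ℝ), IsMonatomicProfile r W S → 0 < Λ → Differentiable ℝ u₁ → Differentiable ℝ u₂ → (∀ x, Λ * u₁ x - ((W x - 1) * deriv u₁ x + 3 * S x * deriv u₂ x + (deriv W x + 2 * W x - r) * u₁ x + (3 * deriv S x + 6 * S x) * u₂ x) = f₁ x ∧ Λ * u₂ x - (S x / 3 * deriv u₁ x + (W x - 1) * deriv u₂ x + (deriv S x + 2 * S x) * u₁ x + (deriv W x / 3 + 2 * W x - r) * u₂ x) = f₂ x) → ∀ N : ℝ, (∀ y, 0 ≤ y → |f₁ y| + |f₂ y| / S y ≤ N) → ∃ N' : ℝ, ∀ y, 0 ≤ y → |u₁ y| + |u₂ y| / S y ≤ N' := by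
  intro r Λ W S u₁ u₂ f₁ f₂ hP hΛ hu₁ hu₂ heq N hN
  obtain ⟨tW, tS, tW', tσ, tD⟩ := profile_farField_limits hP
  obtain ⟨hr1, -, hWs, hSs, hSpos, -, -, -, -⟩ := hP
  have hS1 : Differentiable ℝ S := hSs.differentiable (by simp)
  have hN0 : 0 ≤ N := le_trans (add_nonneg (abs_nonneg _) (div_nonneg (abs_nonneg _) (hSpos 0).le)) (hN 0 le_rfl)
  -- continuous functions of the four atoms `(W, W', S, S'/S) → (0, 0, 0, -r)` converge
  have hat : Tendsto (fun x => (W x, deriv W x, S x, deriv S x / S x)) atTop (𝓝 ((0 : ℝ), (0 : ℝ), (0 : ℝ), -r)) :=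
    tW.prodMk_nhds (tW'.prodMk_nhds (tS.prodMk_nhds tσ))
  have hcomp : ∀ Φ : ℝ → ℝ → ℝ → ℝ → ℝ,
      ContinuousAt (fun v : ℝ × ℝ × ℝ × ℝ => Φ v.1 v.2.1 v.2.2.1 v.2.2.2) ((0 : ℝ), (0 : ℝ), (0 : ℝ), -r) →
      Tendsto (fun x => Φ (W x) (deriv W x) (S x) (deriv S x / S x)) atTop (𝓝 (Φ 0 0 0 (-r))) :=
    fun Φ hΦ => hΦ.tendsto.comp hat
  -- constants
  set lam : ℝ := Λ / 2 with hlam_def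
  have hlam : 0 < lam := by positivity
  set c : ℝ := -(1 / 3) * (Λ + r) + (2 - r) with hc_def
  set ε : ℝ := lam ^ 2 / (8 * c ^ 2 + 8) with hε_def
  have hε : 0 < ε := by positivity
  -- the limits of the eight coefficients
  have tA₁₁ : Tendsto (fun x => ((W x - 1) * (Λ + r - deriv W x - 2 * W x) + 3 * S x ^ 2 * (deriv S x / S x + 2)) /
      ((W x - 1) ^ 2 - S x ^ 2)) atTop (𝓝 (((0 - 1) * (Λ + r - 0 - 2 * 0) + 3 * 0 ^ 2 * (-r + 2)) /
      ((0 - 1) ^ 2 - 0 ^ 2))) :=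
    hcomp (fun a a' b s => ((a - 1) * (Λ + r - a' - 2 * a) + 3 * b ^ 2 * (s + 2)) / ((a - 1) ^ 2 - b ^ 2))
      (ContinuousAt.div (by fun_prop) (by fun_prop) (by norm_num))
  have eA₁₁ : ((0 - 1) * (Λ + r - 0 - 2 * 0) + 3 * 0 ^ 2 * (-r + 2)) / ((0 - 1) ^ 2 - 0 ^ 2) = -(Λ + r) := by ring
  rw [eA₁₁] at tA₁₁
  have tA₁₂ : Tendsto (fun x => (-(W x - 1) * (6 * (deriv S x / S x + 1) * S x ^ 2) -
      3 * S x ^ 2 * (Λ + r - deriv W x / 3 - 2 * W x - (W x - 1) * (deriv S x / S x))) / ((W x - 1) ^ 2 - S x ^ 2))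
      atTop (𝓝 ((-(0 - 1) * (6 * (-r + 1) * 0 ^ 2) - 3 * 0 ^ 2 * (Λ + r - 0 / 3 - 2 * 0 - (0 - 1) * -r)) /
      ((0 - 1) ^ 2 - 0 ^ 2))) :=
    hcomp (fun a a' b s => (-(a - 1) * (6 * (s + 1) * b ^ 2) - 3 * b ^ 2 * (Λ + r - a' / 3 - 2 * a - (a - 1) * s)) /
      ((a - 1) ^ 2 - b ^ 2)) (ContinuousAt.div (by fun_prop) (by fun_prop) (by norm_num))
  have eA₁₂ : (-(0 - 1) * (6 * (-r + 1) * 0 ^ 2) - 3 * 0 ^ 2 * (Λ + r - 0 / 3 - 2 * 0 - (0 - 1) * -r)) /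
      ((0 - 1) ^ 2 - 0 ^ 2) = (0 : ℝ) := by ring
  rw [eA₁₂] at tA₁₂
  have tA₂₁ : Tendsto (fun x => (-(1 / 3) * (Λ + r - deriv W x - 2 * W x) - (W x - 1) * (deriv S x / S x + 2)) /
      ((W x - 1) ^ 2 - S x ^ 2)) atTop (𝓝 ((-(1 / 3) * (Λ + r - 0 - 2 * 0) - (0 - 1) * (-r + 2)) /
      ((0 - 1) ^ 2 - 0 ^ 2))) :=
    hcomp (fun a a' b s => (-(1 / 3) * (Λ + r - a' - 2 * a) - (a - 1) * (s + 2)) / ((a - 1) ^ 2 - b ^ 2))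
      (ContinuousAt.div (by fun_prop) (by fun_prop) (by norm_num))
  have eA₂₁ : (-(1 / 3) * (Λ + r - 0 - 2 * 0) - (0 - 1) * (-r + 2)) / ((0 - 1) ^ 2 - 0 ^ 2) = c := by
    rw [hc_def]; ring
  rw [eA₂₁] at tA₂₁
  have tA₂₂ : Tendsto (fun x => (2 * (deriv S x / S x + 1) * S x ^ 2 +
      (W x - 1) * (Λ + r - deriv W x / 3 - 2 * W x - (W x - 1) * (deriv S x / S x))) / ((W x - 1) ^ 2 - S x ^ 2))
      atTop (𝓝 ((2 * (-r + 1) * 0 ^ 2 + (0 - 1) * (Λ + r - 0 / 3 - 2 * 0 - (0 - 1) * -r)) / ((0 - 1) ^ 2 - 0 ^ 2))) :=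
    hcomp (fun a a' b s => (2 * (s + 1) * b ^ 2 + (a - 1) * (Λ + r - a' / 3 - 2 * a - (a - 1) * s)) /
      ((a - 1) ^ 2 - b ^ 2)) (ContinuousAt.div (by fun_prop) (by fun_prop) (by norm_num))
  have eA₂₂ : (2 * (-r + 1) * 0 ^ 2 + (0 - 1) * (Λ + r - 0 / 3 - 2 * 0 - (0 - 1) * -r)) / ((0 - 1) ^ 2 - 0 ^ 2) =
      -Λ := by ring
  rw [eA₂₂] at tA₂₂
  have tB₁₁ : Tendsto (fun x => -(W x - 1) / ((W x - 1) ^ 2 - S x ^ 2)) atTop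
      (𝓝 (-(0 - 1) / ((0 - 1) ^ 2 - 0 ^ 2))) :=
    hcomp (fun a a' b s => -(a - 1) / ((a - 1) ^ 2 - b ^ 2)) (ContinuousAt.div (by fun_prop) (by fun_prop) (by norm_num))
  have eB₁₁ : -(0 - 1) / ((0 - 1) ^ 2 - 0 ^ 2) = (1 : ℝ) := by norm_num
  rw [eB₁₁] at tB₁₁
  have tB₁₂ : Tendsto (fun x => 3 * S x ^ 2 / ((W x - 1) ^ 2 - S x ^ 2)) atTop
      (𝓝 (3 * 0 ^ 2 / ((0 - 1) ^ 2 - 0 ^ 2))) :=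
    hcomp (fun a a' b s => 3 * b ^ 2 / ((a - 1) ^ 2 - b ^ 2)) (ContinuousAt.div (by fun_prop) (by fun_prop) (by norm_num))
  have eB₁₂ : 3 * 0 ^ 2 / ((0 - 1) ^ 2 - 0 ^ 2) = (0 : ℝ) := by norm_num
  rw [eB₁₂] at tB₁₂
  have tB₂₁ : Tendsto (fun x => 1 / 3 / ((W x - 1) ^ 2 - S x ^ 2)) atTop (𝓝 (1 / 3 / ((0 - 1) ^ 2 - 0 ^ 2))) :=
    hcomp (fun a a' b s => 1 / 3 / ((a - 1) ^ 2 - b ^ 2)) (ContinuousAt.div (by fun_prop) (by fun_prop) (by norm_num))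
  have eB₂₁ : 1 / 3 / ((0 - 1) ^ 2 - 0 ^ 2) = (1 / 3 : ℝ) := by norm_num
  rw [eB₂₁] at tB₂₁
  have tD : Tendsto (fun x => (W x - 1) ^ 2 - S x ^ 2) atTop (𝓝 1) := tD
  -- eventual inequalities
  have ev1 : ∀ᶠ x in atTop, ((W x - 1) * (Λ + r - deriv W x - 2 * W x) + 3 * S x ^ 2 * (deriv S x / S x + 2)) /
      ((W x - 1) ^ 2 - S x ^ 2) < -lam := tA₁₁.eventually (gt_mem_nhds (by rw [hlam_def]; linarith))
  have ev2 : ∀ᶠ x in atTop, (2 * (deriv S x / S x + 1) * S x ^ 2 +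
      (W x - 1) * (Λ + r - deriv W x / 3 - 2 * W x - (W x - 1) * (deriv S x / S x))) / ((W x - 1) ^ 2 - S x ^ 2) <
      -lam := tA₂₂.eventually (gt_mem_nhds (by rw [hlam_def]; linarith))
  have ev3 : ∀ᶠ x in atTop, ((-(W x - 1) * (6 * (deriv S x / S x + 1) * S x ^ 2) -
      3 * S x ^ 2 * (Λ + r - deriv W x / 3 - 2 * W x - (W x - 1) * (deriv S x / S x))) / ((W x - 1) ^ 2 - S x ^ 2) +
      ε * ((-(1 / 3) * (Λ + r - deriv W x - 2 * W x) - (W x - 1) * (deriv S x / S x + 2)) /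
      ((W x - 1) ^ 2 - S x ^ 2))) ^ 2 < ε * lam ^ 2 / 4 := by
    refine ((tA₁₂.add (tA₂₁.const_mul ε)).pow 2).eventually (gt_mem_nhds ?_)
    have h1 : ε * c ^ 2 < lam ^ 2 / 4 := by
      rw [hε_def, div_mul_eq_mul_div, div_lt_div_iff₀ (by positivity) (by positivity)]
      nlinarith [sq_nonneg c, sq_nonneg lam, hlam]
    nlinarith
  have ev4 : ∀ᶠ x in atTop, |-(W x - 1) / ((W x - 1) ^ 2 - S x ^ 2)| + |3 * S x ^ 2 / ((W x - 1) ^ 2 - S x ^ 2)| < 3 :=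
    (tB₁₁.abs.add tB₁₂.abs).eventually (gt_mem_nhds (by norm_num))
  have ev5 : ∀ᶠ x in atTop, |1 / 3 / ((W x - 1) ^ 2 - S x ^ 2)| + |-(W x - 1) / ((W x - 1) ^ 2 - S x ^ 2)| < 3 :=
    (tB₂₁.abs.add tB₁₁.abs).eventually (gt_mem_nhds (by norm_num))
  have ev6 : ∀ᶠ x in atTop, (1 / 2 : ℝ) < (W x - 1) ^ 2 - S x ^ 2 := tD.eventually (lt_mem_nhds (by norm_num))
  have ev7 : ∀ᶠ x in atTop, (0 : ℝ) ≤ x := eventually_ge_atTop 0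
  obtain ⟨X₀, hX₀⟩ := (ev1.and (ev2.and (ev3.and (ev4.and (ev5.and (ev6.and ev7)))))).exists_forall_of_atTop
  -- source bounds
  have hf₁ : ∀ x, 0 ≤ x → |f₁ x| ≤ N := fun x hx => by
    have h := hN x hx
    have : 0 ≤ |f₂ x| / S x := div_nonneg (abs_nonneg _) (hSpos x).le
    linarith
  have hf₂ : ∀ x, 0 ≤ x → |f₂ x / S x| ≤ N := fun x hx => by
    have h := hN x hx
    rw [abs_div, abs_of_pos (hSpos x)]
    linarith [abs_nonneg (f₁ x)]
  -- apply the abstract lemma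
  obtain ⟨M, hM⟩ := bounded_of_decaying_system (p := u₁) (p' := deriv u₁) (q := fun x => u₂ x / S x)
    (q' := fun x => (deriv u₂ x * S x - u₂ x * deriv S x) / S x ^ 2)
    (A₁₁ := fun x => ((W x - 1) * (Λ + r - deriv W x - 2 * W x) + 3 * S x ^ 2 * (deriv S x / S x + 2)) /
      ((W x - 1) ^ 2 - S x ^ 2))
    (A₁₂ := fun x => (-(W x - 1) * (6 * (deriv S x / S x + 1) * S x ^ 2) -
      3 * S x ^ 2 * (Λ + r - deriv W x / 3 - 2 * W x - (W x - 1) * (deriv S x / S x))) / ((W x - 1) ^ 2 - S x ^ 2))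
    (A₂₁ := fun x => (-(1 / 3) * (Λ + r - deriv W x - 2 * W x) - (W x - 1) * (deriv S x / S x + 2)) /
      ((W x - 1) ^ 2 - S x ^ 2))
    (A₂₂ := fun x => (2 * (deriv S x / S x + 1) * S x ^ 2 +
      (W x - 1) * (Λ + r - deriv W x / 3 - 2 * W x - (W x - 1) * (deriv S x / S x))) / ((W x - 1) ^ 2 - S x ^ 2))
    (g₁ := fun x => -(W x - 1) / ((W x - 1) ^ 2 - S x ^ 2) * f₁ x + 3 * S x ^ 2 / ((W x - 1) ^ 2 - S x ^ 2) * (f₂ x / S x))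
    (g₂ := fun x => 1 / 3 / ((W x - 1) ^ 2 - S x ^ 2) * f₁ x + -(W x - 1) / ((W x - 1) ^ 2 - S x ^ 2) * (f₂ x / S x))
    (X₀ := X₀) (G := 3 * N) hlam hε
    (fun x _ => (hu₁ x).hasDerivAt)
    (fun x _ => ((hu₂ x).hasDerivAt.div (hS1 x).hasDerivAt (hSpos x).ne'))
    (fun x hx => (farField_cramer Λ r (W x) (deriv W x) (S x) (deriv S x) (u₁ x) (deriv u₁ x) (u₂ x) (deriv u₂ x)
      (f₁ x) (f₂ x) (hSpos x).ne' (by have := (hX₀ x hx).2.2.2.2.2.1; linarith) (heq x).1 (heq x).2).1)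
    (fun x hx => (farField_cramer Λ r (W x) (deriv W x) (S x) (deriv S x) (u₁ x) (deriv u₁ x) (u₂ x) (deriv u₂ x)
      (f₁ x) (f₂ x) (hSpos x).ne' (by have := (hX₀ x hx).2.2.2.2.2.1; linarith) (heq x).1 (heq x).2).2)
    (fun x hx => (hX₀ x hx).1.le) (fun x hx => (hX₀ x hx).2.1.le) (fun x hx => (hX₀ x hx).2.2.1.le)
    (fun x hx => by
      obtain ⟨-, -, -, h4, -, -, h7⟩ := hX₀ x hx
      have a1 := hf₁ x h7
      have a2 := hf₂ x h7
      calc _ ≤ |-(W x - 1) / ((W x - 1) ^ 2 - S x ^ 2) * f₁ x| + |3 * S x ^ 2 / ((W x - 1) ^ 2 - S x ^ 2) * (f₂ x / S x)| :=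
            abs_add_le _ _
        _ = |-(W x - 1) / ((W x - 1) ^ 2 - S x ^ 2)| * |f₁ x| + |3 * S x ^ 2 / ((W x - 1) ^ 2 - S x ^ 2)| * |f₂ x / S x| := by
            rw [abs_mul, abs_mul]
        _ ≤ |-(W x - 1) / ((W x - 1) ^ 2 - S x ^ 2)| * N + |3 * S x ^ 2 / ((W x - 1) ^ 2 - S x ^ 2)| * N := by
            gcongr
        _ ≤ 3 * N := by nlinarith [mul_nonneg (sub_nonneg.2 h4.le) hN0])
    (fun x hx => by
      obtain ⟨-, -, -, -, h5, -, h7⟩ := hX₀ x hx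
      have a1 := hf₁ x h7
      have a2 := hf₂ x h7
      calc _ ≤ |1 / 3 / ((W x - 1) ^ 2 - S x ^ 2) * f₁ x| + |-(W x - 1) / ((W x - 1) ^ 2 - S x ^ 2) * (f₂ x / S x)| :=
            abs_add_le _ _
        _ = |1 / 3 / ((W x - 1) ^ 2 - S x ^ 2)| * |f₁ x| + |-(W x - 1) / ((W x - 1) ^ 2 - S x ^ 2)| * |f₂ x / S x| := by
            rw [abs_mul, abs_mul]
        _ ≤ |1 / 3 / ((W x - 1) ^ 2 - S x ^ 2)| * N + |-(W x - 1) / ((W x - 1) ^ 2 - S x ^ 2)| * N := by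
            gcongr
        _ ≤ 3 * N := by nlinarith [mul_nonneg (sub_nonneg.2 h5.le) hN0])
  -- the compact part `[0, X₀]` and assembly
  have hφ : Continuous fun y => |u₁ y| + |u₂ y| / S y :=
    hu₁.continuous.abs.add (hu₂.continuous.abs.div hSs.continuous fun y => (hSpos y).ne')
  obtain ⟨M', hM'⟩ := (isCompact_Icc : IsCompact (Icc 0 X₀)).exists_bound_of_continuousOn hφ.continuousOn
  refine ⟨max (2 * M) M', fun y hy => ?_⟩
  rcases le_or_gt X₀ y with hXy | hXy
  · obtain ⟨h1, h2⟩ := hM y hXy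
    have h3 : |u₂ y| / S y = |u₂ y / S y| := by rw [abs_div, abs_of_pos (hSpos y)]
    rw [h3]
    exact le_trans (by linarith) (le_max_left _ _)
  · have h := hM' y ⟨hy, hXy.le⟩
    rw [Real.norm_eq_abs] at h
    exact le_trans ((le_abs_self _).trans h) (le_max_right _ _)

end Summit.AtomisticToContinuum.HydrodynamicLimit.Theorems.PackingAnalyticImplosion

end
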